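import Literature.MathematicalPhysics.QuantumFieldTheory.Balaban1983to89.B9BackgroundsKLevelV1R
import Literature.MathematicalPhysics.QuantumFieldTheory.Balaban1983to89.B9Thm37Whole
import Literature.MathematicalPhysics.QuantumFieldTheory.Balaban1983to89.B9Thm37WholeDir
import Literature.MathematicalPhysics.QuantumFieldTheory.Balaban1983to89.B9Thm37KLetterDir
import Literature.MathematicalPhysics.QuantumFieldTheory.Balaban1983to89.B9Cor38Whole
import Literature.MathematicalPhysics.QuantumFieldTheory.Balaban1983to89.B9Cor38WholeDir
import Literature.MathematicalPhysics.QuantumFieldTheory.Balaban1983to89.B9RWSums343Holder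
import Literature.MathematicalPhysics.QuantumFieldTheory.Balaban1983to89.B9RWSums343HolderGp
import Literature.MathematicalPhysics.QuantumFieldTheory.Balaban1983to89.B9RWSums344Input
import Literature.MathematicalPhysics.QuantumFieldTheory.Balaban1983to89.B9RWSums344InputGp
import Literature.MathematicalPhysics.QuantumFieldTheory.Balaban1983to89.B9RWSums344InputPair
import Literature.MathematicalPhysics.QuantumFieldTheory.Balaban1983to89.B9RWSums346Two
import Literature.MathematicalPhysics.QuantumFieldTheory.Balaban1983to89.B9RWSums346TwoGp
import Literature.MathematicalPhysics.QuantumFieldTheory.Balaban1983to89.B9RWSums346MixedPair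
import Literature.MathematicalPhysics.QuantumFieldTheory.Balaban1983to89.B9RWSums346SecondDiff
import Literature.MathematicalPhysics.QuantumFieldTheory.Balaban1983to89.B9RWSums346SecondDiffGp
import Literature.MathematicalPhysics.QuantumFieldTheory.Balaban1983to89.B9Thm310Whole
import Literature.MathematicalPhysics.QuantumFieldTheory.Balaban1983to89.B9Thm310WholeDir
import Literature.MathematicalPhysics.QuantumFieldTheory.Balaban1983to89.B9Thm312Whole
import Literature.MathematicalPhysics.QuantumFieldTheory.Balaban1983to89.B9Thm312WholeLeftStepFrom3131
import Literature.MathematicalPhysics.QuantumFieldTheory.Balaban1983to89.B9Thm312WholeHZ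

/-!
# `Balaban1983to89.B9OpsRTransport` — Stage-3′(Y) MODULE 3-R, §3 continued: the FIELDWISE RE-TYPING of the operator-LETTER records of Theorems 3.7 ∕ 3.10 ∕
# 3.12–3.13 (`B9Thm37Whole.Ops`, `B9Thm310Whole.Ops310`, `B9Thm312Whole.Ops` and their direction ∕ probe ∕ walk-reading companions) between the member
# background `bg9Y x` and the class-parametric carrier `bg9YR R₁ R₂ x`, and the induced equivalences of every displayed SCHEMA

statement-level skeleton of published theorems with citation tags; proofs where landed; nothing here is a claim about the Yang–Mills mass gap

B9 = T. Bałaban, *Propagators for lattice gauge theories in a background field*, Commun. Math. Phys. **99** (1985) 389–434 [Balaban1985BackgroundPropagators].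
THE PRINT.  p. 396: the regularity conditions (3.35)–(3.36) on the background `U` («U restricted to each big cube □̃ … is a small field», «regular») are
HYPOTHESES on the configuration; the operators of Theorems 3.7 (p. 409), 3.10 (pp. 415–416), 3.12–3.13 (pp. 423–426) and all the objects of their random-walk
expansions are functions of the configuration `U` alone.  In the tree the member background `bg9Y x : B9.Backgrounds` FIXES the two regularity predicates
(MODULE 3), while `bg9YR R₁ R₂ x` (MODULE 3-R, `B9BackgroundsKLevelV1R`) takes them as PARAMETERS; both have the SAME configurations, units and products
(`bg9YR_Cfg_eq ∕ _one_eq ∕ _mul_eq`, `rfl`), and `bg9Y x = bg9YR regY335 regY336 x` (`bg9Y_eq_bg9YR`, `rfl`).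

WHY THIS FILE (pub-ymgap bus 2026-08-28: dag-n06-w7 g2 OFFER-1 «(A) per-face R-twins ∕ (B) one fieldwise re-typing»; dag-n06-d g13 WORD «(B)»; node00-def-Y g24
«MINE» = INTENT-57; dag-lead DEDUP-402 «ONE declarer = def-Y»).  The STEP-3 R-edition of the N06 certificate binds its operator letters over `bg9YR R₁ R₂ x`
(the R-faces of dag-n06-i read them there), while the whole Y-lineage of faces (dag-n06-w1∕w7's cube estimates, the H-files, def-Y's instances) is typed
over `bg9Y x`.  Every field of the letter records reads the background ONLY through `B.Cfg`, so ONE fieldwise re-typing lets the R-edition consume every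
`Ops`-typed Y-face UNCHANGED — no per-face twins.  §1 of `B9BackgroundsKLevelV1R` already re-types the KERNEL records (`kernelFamilyR∕RY`, `siteKernelR`,
`fineKernelR`, `rwExpansionR`, `rwKernelExpansionR`, `hKernelR∕RY`); this file does the same one layer up, for the operator letters.

WHAT THIS FILE DOES (definitions by field copy + `rfl` round trips + schema equivalences by `cases ∕ constructor ∕ assumption`; nothing of [B9] asserted):
* §1 ★★ TRANSPORTS (both directions, mutually inverse by `rfl`, the identity at MODULE 3's families by `rfl`): `opsRY ∕ opsYR` (Theorem 3.7's 30-field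
  record), `dirOps37RY∕YR`, `dirLetters37RY∕YR`, `holderProbesRY∕YR`, `walkReadingRY∕YR`; `ops310RY∕YR` (Theorem 3.10's record), `dirOps310RY∕YR`,
  `dirLetters310RY∕YR`, `walkReading310RY∕YR`; `ops312RY∕YR` (Theorems 3.12–3.13's Sect.-D record).
* §2 ★★ SCHEMA BRIDGES, Theorem-3.7 layer — for each displayed ∕ read schema `S`, `S (opsRY 𝔬) (companions…) … ↔ S 𝔬 …`: `StaticOK`, `Local342`, `Identities`,
  `Identities₂`, `Locality`, `LocalityDir`, `WalkReading.OK`, `DirTranspose37`, `HolderLegs37`, `HolderV37Dir`, `L2TwoLegs37`, `FactorsL2_37`, `L2SecondLegs37`,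
  `FactorsL2Second37(Dir)`, `L2MixedLegs37`, `FactorsL2Mixed37(Dir)`, `InputLegs37`, `InputLegsPair37`, `FactorsInputPair37(Dir)`, `DirSupSq37`, `DirSup37`, `DirSupHolder37`.
* §3 ★★ SCHEMA BRIDGES, Theorem-3.10 layer: `StaticOK310`, `Local342G`, `Identities310`, `Identities310₂`, `Locality310`, `WalkReading310.OK`, `DirTranspose310`,
  `HolderLegs310`, `FactorsHolder310`, `L2TwoLegs310`, `FactorsL2_310`, `L2SecondLegs310`, `FactorsL2Second310`, `L2MixedLegs310`, `FactorsL2Mixed310`, `InputLegs310`,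
  `InputLegsPair310`, `FactorsInputPair310`, `DirSupSq310`, `DirSup310`, `DirSupHolder310`.
* §4 ★ SCHEMA BRIDGES, Sect.-D layer (the two letter schemas displayed as `Ops`-typed binders today): `Letters3131H`, `LettersHZ`; the `Letters313*` ∕ `Thm33G0*` family of
  rows 20–21 is bridged the same way (one line each) when the R-edition reaches them — a v1.x of THIS file, by name, on request.
The geometry `g` is GENERIC (instantiate `g := geo9Y x`); only the background pair `bg9YR R₁ R₂ x ∕ bg9Y x` is fixed.
A schema not listed is either `Ops`-free (e.g. `CurrentMaj`, the `HasMajorant` rows of the Sect.-D letters — they read record FIELDS, on which the transports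
are `rfl`) or is bridged the same way on request (one `cases ∕ constructor ∕ assumption` line).

HONEST SCOPE.  Bookkeeping only: field copies across two background records with identical configuration types, and the tautological equivalences of
predicates that read the background only through its configurations; no inequality, expansion or identity of the paper is proved or asserted; the
class-content implications between `R₁ ∕ R₂` and MODULE 3's families stay the R-edition's displayed hypotheses (RULING-2 (c)).  Nothing landed is
modified; N06 is NOT discharged; NOT continuum, NOT OS, NOT the mass gap.  Filed by the pub-ymgap def-Y owner lineage (`pub-ymgap-node00-def-Y`, gen 24).
Net new unproved facts: 0.
-/

noncomputable section

namespace Literature.MathematicalPhysics.QuantumFieldTheory.Balaban1983to89.B9OpsRTransport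

open B9PinMembersKLevelV1 (MemberY bg9Y)
open B9BackgroundsKLevelV1R (RegFamY bg9YR regY335 regY336)
open B9Thm34Ext (toB6)
open B11SectG (BlockNorm)
open B9Thm37Whole (Ops Sizes StaticOK Local342 Identities)
open B9Thm37WholeDir (DirLetters37 Identities₂ DirSupSq37)
open B9Thm37KLetterDir (HolderV37Dir FactorsInputPair37Dir FactorsL2Mixed37Dir FactorsL2Second37Dir)
open B9Cor38Whole (WalkReading Locality)
open B9Cor38WholeDir (LocalityDir)
open B9RWSums343Holder (HolderProbes HolderLegs310 FactorsHolder310)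
open B9RWSums343HolderGp (HolderLegs37)
open B9RWSums344InputPair (InputLegsPair37 FactorsInputPair37 DirSupHolder37 InputLegsPair310 FactorsInputPair310 DirSupHolder310)
open B9RWSums344InputGp (InputLegs37)
open B9RWSums344Input (InputLegs310)
open B9RWSums346TwoGp (L2TwoLegs37 FactorsL2_37)
open B9RWSums346Two (L2TwoLegs310 FactorsL2_310)
open B9RWSums346MixedPair (L2MixedLegs37 FactorsL2Mixed37 DirSup37 L2MixedLegs310 FactorsL2Mixed310 DirSup310)
open B9RWSums346SecondDiff (DirOps310 DirTranspose310 L2SecondLegs310 FactorsL2Second310)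
open B9RWSums346SecondDiffGp (DirOps37 DirTranspose37 L2SecondLegs37 FactorsL2Second37)
open B9Thm310Whole (Ops310 WalkReading310 Sizes310 StaticOK310 Local342G Identities310 Locality310)
open B9Thm310WholeDir (DirLetters310 Identities310₂ DirSupSq310)
open B9Thm312WholeLeftStepFrom3131 (Letters3131H)
open B9Thm312WholeHZ (LettersHZ)
open B9Thm312Whole (GeoOK)

variable {d ℓ : ℕ} {hd : 1 ≤ d + 1} {hL : Odd (ℓ + 1) ∧ 1 < ℓ + 1} {b₀ b₁ : ℝ} {Mstar : ℕ}
variable {𝔸 : Type} [NormedRing 𝔸] [NormedAlgebra ℂ 𝔸] [CompleteSpace 𝔸] {G : Subgroup 𝔸ˣ}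
variable {R₁ R₂ : RegFamY d ℓ hd hL b₀ b₁ Mstar 𝔸} {x : MemberY d ℓ hd hL b₀ b₁ Mstar} {g : B9.Geometry}

/-! ## §1 ★★ Transports of the operator-letter records (field copies; same configurations, same entries) -/

section Transport37

variable {X Y ι P Dir PX PY : Type}

/-- ★★ Theorem 3.7's operator letters over `bg9YR R₁ R₂ x` ARE letters over `bg9Y x` (all thirty fields read the background through `B.Cfg` only).
[cite: Balaban1985BackgroundPropagators, Thm 3.7 (3.90) p.409 + (3.35)–(3.36) p.396, bookkeeping] -/
def opsRY (𝔬 : Ops g (bg9YR 𝔸 G R₁ R₂ x) X Y ι) : Ops g (bg9Y 𝔸 G x) X Y ι :=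
  ⟨𝔬.blk, 𝔬.blkY, 𝔬.S, 𝔬.S', 𝔬.h, 𝔬.hY, 𝔬.KP, 𝔬.KC, 𝔬.KPD, 𝔬.KCD, 𝔬.KPL, 𝔬.KCL, 𝔬.KPt, 𝔬.KCt, 𝔬.KCLt, 𝔬.Gp, 𝔬.Δa, 𝔬.Gsq, 𝔬.D, 𝔬.Dstar, 𝔬.Lap,
    𝔬.P, 𝔬.Cop, 𝔬.PD, 𝔬.CD, 𝔬.PL, 𝔬.CL, 𝔬.Pt, 𝔬.Ct, 𝔬.CLt⟩

variable (R₁ R₂) in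
/-- … and conversely. [cite: Balaban1985BackgroundPropagators, Thm 3.7 (3.90) p.409 + (3.35)–(3.36) p.396, bookkeeping] -/
def opsYR (𝔬 : Ops g (bg9Y 𝔸 G x) X Y ι) : Ops g (bg9YR 𝔸 G R₁ R₂ x) X Y ι :=
  ⟨𝔬.blk, 𝔬.blkY, 𝔬.S, 𝔬.S', 𝔬.h, 𝔬.hY, 𝔬.KP, 𝔬.KC, 𝔬.KPD, 𝔬.KCD, 𝔬.KPL, 𝔬.KCL, 𝔬.KPt, 𝔬.KCt, 𝔬.KCLt, 𝔬.Gp, 𝔬.Δa, 𝔬.Gsq, 𝔬.D, 𝔬.Dstar, 𝔬.Lap,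
    𝔬.P, 𝔬.Cop, 𝔬.PD, 𝔬.CD, 𝔬.PL, 𝔬.CL, 𝔬.Pt, 𝔬.Ct, 𝔬.CLt⟩

/-- round trip. [cite: Balaban1985BackgroundPropagators, p.409, bookkeeping] -/
theorem opsRY_opsYR (𝔬 : Ops g (bg9Y 𝔸 G x) X Y ι) : opsRY (opsYR R₁ R₂ 𝔬) = 𝔬 := rfl
/-- round trip. [cite: Balaban1985BackgroundPropagators, p.409, bookkeeping] -/
theorem opsYR_opsRY (𝔬 : Ops g (bg9YR 𝔸 G R₁ R₂ x) X Y ι) : opsYR R₁ R₂ (opsRY 𝔬) = 𝔬 := rfl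
/-- at MODULE 3's families the transport is the identity (`bg9Y = bg9YR regY335 regY336`, structure eta). [cite: Balaban1985BackgroundPropagators, p.396, bookkeeping] -/
theorem opsRY_regY (𝔬 : Ops g (bg9YR 𝔸 G (regY335 𝔸 G) (regY336 𝔸 G) x) X Y ι) : opsRY 𝔬 = 𝔬 := rfl
/-- the site propagator letter is copied. [cite: Balaban1985BackgroundPropagators, Thm 3.7 (3.90) p.409, bookkeeping] -/
theorem opsRY_Gp (𝔬 : Ops g (bg9YR 𝔸 G R₁ R₂ x) X Y ι) : (opsRY 𝔬).Gp = 𝔬.Gp := rfl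
/-- the block map is copied. [cite: Balaban1985BackgroundPropagators, p.409, bookkeeping] -/
theorem opsRY_blk (𝔬 : Ops g (bg9YR 𝔸 G R₁ R₂ x) X Y ι) : (opsRY 𝔬).blk = 𝔬.blk := rfl

/-- Theorem 3.7's direction operators `∇_μ ∕ ∇*_μ` over the transported letters. [cite: Balaban1985BackgroundPropagators, (3.46) p.398 + Cor. 3.6 p.408, bookkeeping] -/
def dirOps37RY {𝔬 : Ops g (bg9YR 𝔸 G R₁ R₂ x) X Y ι} (𝔡 : DirOps37 𝔬 P) : DirOps37 (opsRY 𝔬) P := ⟨𝔡.Dd, 𝔡.Dsd⟩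
/-- … and conversely. [cite: Balaban1985BackgroundPropagators, (3.46) p.398, bookkeeping] -/
def dirOps37YR {𝔬 : Ops g (bg9Y 𝔸 G x) X Y ι} (𝔡 : DirOps37 𝔬 P) : DirOps37 (opsYR R₁ R₂ 𝔬) P := ⟨𝔡.Dd, 𝔡.Dsd⟩
/-- Theorem 3.7's per-direction Poisson letters over the transported letters. [cite: Balaban1985BackgroundPropagators, (3.88) p.408, bookkeeping] -/
def dirLetters37RY {𝔬 : Ops g (bg9YR 𝔸 G R₁ R₂ x) X Y ι} (𝔩 : DirLetters37 𝔬 Dir) : DirLetters37 (opsRY 𝔬) Dir :=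
  ⟨𝔩.P, 𝔩.PL, 𝔩.Pt, 𝔩.KPd, 𝔩.KPLd, 𝔩.KPtd⟩
/-- … and conversely. [cite: Balaban1985BackgroundPropagators, (3.88) p.408, bookkeeping] -/
def dirLetters37YR {𝔬 : Ops g (bg9Y 𝔸 G x) X Y ι} (𝔩 : DirLetters37 𝔬 Dir) : DirLetters37 (opsYR R₁ R₂ 𝔬) Dir :=
  ⟨𝔩.P, 𝔩.PL, 𝔩.Pt, 𝔩.KPd, 𝔩.KPLd, 𝔩.KPtd⟩
/-- the Hölder probes (3.43)–(3.44) over `bg9YR` ARE probes over `bg9Y`. [cite: Balaban1985BackgroundPropagators, (3.43)–(3.44) p.397, bookkeeping] -/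
def holderProbesRY (𝔭 : HolderProbes g (bg9YR 𝔸 G R₁ R₂ x) X Y PX PY) : HolderProbes g (bg9Y 𝔸 G x) X Y PX PY :=
  ⟨𝔭.blkPX, 𝔭.blkPY, 𝔭.ΦX, 𝔭.ΦY⟩
variable (R₁ R₂) in
/-- … and conversely. [cite: Balaban1985BackgroundPropagators, (3.43)–(3.44) p.397, bookkeeping] -/
def holderProbesYR (𝔭 : HolderProbes g (bg9Y 𝔸 G x) X Y PX PY) : HolderProbes g (bg9YR 𝔸 G R₁ R₂ x) X Y PX PY :=
  ⟨𝔭.blkPX, 𝔭.blkPY, 𝔭.ΦX, 𝔭.ΦY⟩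
/-- Corollary 3.8's walk reading over `bg9YR` IS one over `bg9Y`. [cite: Balaban1985BackgroundPropagators, Cor. 3.8 (3.93)–(3.94) p.410, bookkeeping] -/
def walkReadingRY (rd : WalkReading g (bg9YR 𝔸 G R₁ R₂ x) X ι) : WalkReading g (bg9Y 𝔸 G x) X ι := ⟨rd.ev, rd.Agree⟩
variable (R₁ R₂) in
/-- … and conversely. [cite: Balaban1985BackgroundPropagators, Cor. 3.8 (3.93)–(3.94) p.410, bookkeeping] -/
def walkReadingYR (rd : WalkReading g (bg9Y 𝔸 G x) X ι) : WalkReading g (bg9YR 𝔸 G R₁ R₂ x) X ι := ⟨rd.ev, rd.Agree⟩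
/-- round trip. [cite: Balaban1985BackgroundPropagators, p.410, bookkeeping] -/
theorem walkReadingRY_walkReadingYR (rd : WalkReading g (bg9Y 𝔸 G x) X ι) : walkReadingRY (walkReadingYR R₁ R₂ rd) = rd := rfl
/-- round trip. [cite: Balaban1985BackgroundPropagators, p.397, bookkeeping] -/
theorem holderProbesRY_holderProbesYR (𝔭 : HolderProbes g (bg9Y 𝔸 G x) X Y PX PY) : holderProbesRY (holderProbesYR R₁ R₂ 𝔭) = 𝔭 := rfl

end Transport37

section Transport310

variable {X Y ι A P Dir : Type}

/-- ★★ Theorem 3.10's operator letters over `bg9YR R₁ R₂ x` ARE letters over `bg9Y x`. [cite: Balaban1985BackgroundPropagators, Thm 3.10 (3.107)–(3.108) pp.415–416 + (3.35)–(3.36) p.396, bookkeeping] -/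
def ops310RY (𝔬 : Ops310 g (bg9YR 𝔸 G R₁ R₂ x) X Y ι A) : Ops310 g (bg9Y 𝔸 G x) X Y ι A :=
  ⟨𝔬.blk, 𝔬.blkY, 𝔬.S, 𝔬.S', 𝔬.SF, 𝔬.h, 𝔬.hY, 𝔬.KPD, 𝔬.KCD, 𝔬.KPL, 𝔬.KCL, 𝔬.KCLt, 𝔬.G, 𝔬.Δa, 𝔬.Gsq, 𝔬.Rf, 𝔬.Rt, 𝔬.D, 𝔬.Dstar, 𝔬.Lap,
    𝔬.PD, 𝔬.CD, 𝔬.PL, 𝔬.CL, 𝔬.CLt⟩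
variable (R₁ R₂) in
/-- … and conversely. [cite: Balaban1985BackgroundPropagators, Thm 3.10 (3.107)–(3.108) pp.415–416, bookkeeping] -/
def ops310YR (𝔬 : Ops310 g (bg9Y 𝔸 G x) X Y ι A) : Ops310 g (bg9YR 𝔸 G R₁ R₂ x) X Y ι A :=
  ⟨𝔬.blk, 𝔬.blkY, 𝔬.S, 𝔬.S', 𝔬.SF, 𝔬.h, 𝔬.hY, 𝔬.KPD, 𝔬.KCD, 𝔬.KPL, 𝔬.KCL, 𝔬.KCLt, 𝔬.G, 𝔬.Δa, 𝔬.Gsq, 𝔬.Rf, 𝔬.Rt, 𝔬.D, 𝔬.Dstar, 𝔬.Lap,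
    𝔬.PD, 𝔬.CD, 𝔬.PL, 𝔬.CL, 𝔬.CLt⟩
/-- round trip. [cite: Balaban1985BackgroundPropagators, p.416, bookkeeping] -/
theorem ops310RY_ops310YR (𝔬 : Ops310 g (bg9Y 𝔸 G x) X Y ι A) : ops310RY (ops310YR R₁ R₂ 𝔬) = 𝔬 := rfl
/-- round trip. [cite: Balaban1985BackgroundPropagators, p.416, bookkeeping] -/
theorem ops310YR_ops310RY (𝔬 : Ops310 g (bg9YR 𝔸 G R₁ R₂ x) X Y ι A) : ops310YR R₁ R₂ (ops310RY 𝔬) = 𝔬 := rfl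
/-- identity at MODULE 3's families. [cite: Balaban1985BackgroundPropagators, p.396, bookkeeping] -/
theorem ops310RY_regY (𝔬 : Ops310 g (bg9YR 𝔸 G (regY335 𝔸 G) (regY336 𝔸 G) x) X Y ι A) : ops310RY 𝔬 = 𝔬 := rfl
/-- Theorem 3.10's direction operators over the transported letters. [cite: Balaban1985BackgroundPropagators, (3.46) p.398 + Cor. 3.6 p.408, bookkeeping] -/
def dirOps310RY {𝔬 : Ops310 g (bg9YR 𝔸 G R₁ R₂ x) X Y ι A} (𝔡 : DirOps310 𝔬 P) : DirOps310 (ops310RY 𝔬) P := ⟨𝔡.Dd, 𝔡.Dsd⟩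
/-- … and conversely. [cite: Balaban1985BackgroundPropagators, (3.46) p.398, bookkeeping] -/
def dirOps310YR {𝔬 : Ops310 g (bg9Y 𝔸 G x) X Y ι A} (𝔡 : DirOps310 𝔬 P) : DirOps310 (ops310YR R₁ R₂ 𝔬) P := ⟨𝔡.Dd, 𝔡.Dsd⟩
/-- Theorem 3.10's per-direction letters over the transported letters. [cite: Balaban1985BackgroundPropagators, (3.105) p.415, bookkeeping] -/
def dirLetters310RY {𝔬 : Ops310 g (bg9YR 𝔸 G R₁ R₂ x) X Y ι A} (𝔩 : DirLetters310 𝔬 Dir) : DirLetters310 (ops310RY 𝔬) Dir := ⟨𝔩.PLd, 𝔩.KPLd⟩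
/-- … and conversely. [cite: Balaban1985BackgroundPropagators, (3.105) p.415, bookkeeping] -/
def dirLetters310YR {𝔬 : Ops310 g (bg9Y 𝔸 G x) X Y ι A} (𝔩 : DirLetters310 𝔬 Dir) : DirLetters310 (ops310YR R₁ R₂ 𝔬) Dir := ⟨𝔩.PLd, 𝔩.KPLd⟩
/-- Theorem 3.10's walk reading over `bg9YR` IS one over `bg9Y`. [cite: Balaban1985BackgroundPropagators, Thm 3.10 p.416 + Cor. 3.8 p.410, bookkeeping] -/
def walkReading310RY (rd : WalkReading310 g (bg9YR 𝔸 G R₁ R₂ x) X ι A) : WalkReading310 g (bg9Y 𝔸 G x) X ι A :=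
  ⟨rd.ev, rd.Agree, rd.AgreeF⟩
variable (R₁ R₂) in
/-- … and conversely. [cite: Balaban1985BackgroundPropagators, Thm 3.10 p.416 + Cor. 3.8 p.410, bookkeeping] -/
def walkReading310YR (rd : WalkReading310 g (bg9Y 𝔸 G x) X ι A) : WalkReading310 g (bg9YR 𝔸 G R₁ R₂ x) X ι A :=
  ⟨rd.ev, rd.Agree, rd.AgreeF⟩
/-- round trip. [cite: Balaban1985BackgroundPropagators, p.416, bookkeeping] -/
theorem walkReading310RY_walkReading310YR (rd : WalkReading310 g (bg9Y 𝔸 G x) X ι A) :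
    walkReading310RY (walkReading310YR R₁ R₂ rd) = rd := rfl

end Transport310

section Transport312

variable {X Y Z W : Type}

/-- ★★ Theorems 3.12–3.13's Sect.-D letters over `bg9YR R₁ R₂ x` ARE letters over `bg9Y x`. [cite: Balaban1985BackgroundPropagators, Thm 3.12 p.423 + Thm 3.13 p.426 + (3.35)–(3.36) p.396, bookkeeping] -/
def ops312RY (𝔬 : B9Thm312Whole.Ops g (bg9YR 𝔸 G R₁ R₂ x) X Y Z W) : B9Thm312Whole.Ops g (bg9Y 𝔸 G x) X Y Z W :=
  ⟨𝔬.blk, 𝔬.blkY, 𝔬.blkZ, 𝔬.blkW, 𝔬.G0, 𝔬.S0, 𝔬.Tpi, 𝔬.T2, 𝔬.G, 𝔬.G1, 𝔬.GG, 𝔬.D, 𝔬.Dstar, 𝔬.Q, 𝔬.Qstar, 𝔬.C, 𝔬.C1, 𝔬.Hm, 𝔬.H1m, 𝔬.Dv,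
    𝔬.Dvstar, 𝔬.R⟩
variable (R₁ R₂) in
/-- … and conversely. [cite: Balaban1985BackgroundPropagators, Thm 3.12 p.423 + Thm 3.13 p.426, bookkeeping] -/
def ops312YR (𝔬 : B9Thm312Whole.Ops g (bg9Y 𝔸 G x) X Y Z W) : B9Thm312Whole.Ops g (bg9YR 𝔸 G R₁ R₂ x) X Y Z W :=
  ⟨𝔬.blk, 𝔬.blkY, 𝔬.blkZ, 𝔬.blkW, 𝔬.G0, 𝔬.S0, 𝔬.Tpi, 𝔬.T2, 𝔬.G, 𝔬.G1, 𝔬.GG, 𝔬.D, 𝔬.Dstar, 𝔬.Q, 𝔬.Qstar, 𝔬.C, 𝔬.C1, 𝔬.Hm, 𝔬.H1m, 𝔬.Dv,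
    𝔬.Dvstar, 𝔬.R⟩
/-- round trip. [cite: Balaban1985BackgroundPropagators, p.423, bookkeeping] -/
theorem ops312RY_ops312YR (𝔬 : B9Thm312Whole.Ops g (bg9Y 𝔸 G x) X Y Z W) : ops312RY (ops312YR R₁ R₂ 𝔬) = 𝔬 := rfl
/-- round trip. [cite: Balaban1985BackgroundPropagators, p.423, bookkeeping] -/
theorem ops312YR_ops312RY (𝔬 : B9Thm312Whole.Ops g (bg9YR 𝔸 G R₁ R₂ x) X Y Z W) : ops312YR R₁ R₂ (ops312RY 𝔬) = 𝔬 := rfl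
/-- identity at MODULE 3's families. [cite: Balaban1985BackgroundPropagators, p.396, bookkeeping] -/
theorem ops312RY_regY (𝔬 : B9Thm312Whole.Ops g (bg9YR 𝔸 G (regY335 𝔸 G) (regY336 𝔸 G) x) X Y Z W) : ops312RY 𝔬 = 𝔬 := rfl

end Transport312

/-! ## §2 ★★ Schema bridges, Theorem-3.7 layer -/

section Bridges37

variable [Fintype g.Site] [DecidableEq g.Site] {X Y ι P Dir PX PY : Type}
variable (𝔬 : Ops g (bg9YR 𝔸 G R₁ R₂ x) X Y ι) (𝔡 : DirOps37 𝔬 P) (𝔡' : DirOps37 𝔬 Dir) (𝔩 : DirLetters37 𝔬 Dir)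
  (𝔭 : HolderProbes g (bg9YR 𝔸 G R₁ R₂ x) X Y PX PY) (rd : WalkReading g (bg9YR 𝔸 G R₁ R₂ x) X ι)

/-- (3.88)'s static letters. [cite: Balaban1985BackgroundPropagators, (3.88)–(3.90) pp.408–409, bookkeeping] -/
theorem staticOK_iff [Fintype ι] (ρ N N' Cℓ : ℝ) (κ : Sizes) : StaticOK (opsRY 𝔬) ρ N N' Cℓ κ ↔ StaticOK 𝔬 ρ N N' Cℓ κ := by
  constructor <;> rintro ⟨⟩ <;> constructor <;> assumption
omit [DecidableEq g.Site] in
/-- (3.42) localized. [cite: Balaban1985BackgroundPropagators, (3.42) p.397, bookkeeping] -/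
theorem local342_iff (R : ℝ) (H : Prop) (B₀ δ₀ : ℝ) (U : (bg9Y 𝔸 G x).Cfg) : Local342 (opsRY 𝔬) R H B₀ δ₀ U ↔ Local342 𝔬 R H B₀ δ₀ U := by
  constructor <;> rintro ⟨⟩ <;> constructor <;> assumption
omit [DecidableEq g.Site] in
/-- Theorem 3.7's operator identities. [cite: Balaban1985BackgroundPropagators, (3.86)–(3.89) p.408, bookkeeping] -/
theorem identities_iff [Fintype ι] (R : ℝ) (H : Prop) (U : (bg9Y 𝔸 G x).Cfg) : Identities (opsRY 𝔬) R H U ↔ Identities 𝔬 R H U := by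
  constructor <;> rintro ⟨⟩ <;> constructor <;> assumption
omit [DecidableEq g.Site] in
/-- Theorem 3.7's per-direction identities. [cite: Balaban1985BackgroundPropagators, (3.86)–(3.89) p.408, bookkeeping] -/
theorem identities₂_iff [Fintype ι] [Fintype Dir] (R : ℝ) (H : Prop) (U : (bg9Y 𝔸 G x).Cfg) :
    Identities₂ (opsRY 𝔬) (dirOps37RY 𝔡') (dirLetters37RY 𝔩) R H U ↔ Identities₂ 𝔬 𝔡' 𝔩 R H U := by
  constructor <;> rintro ⟨⟩ <;> constructor <;> assumption
omit [Fintype g.Site] [DecidableEq g.Site] in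
/-- Corollary 3.8's locality. [cite: Balaban1985BackgroundPropagators, Cor. 3.8 (3.93)–(3.94) p.410, bookkeeping] -/
theorem locality_iff : Locality (opsRY 𝔬) (walkReadingRY rd) ↔ Locality 𝔬 rd := by
  constructor <;> rintro ⟨⟩ <;> constructor <;> assumption
omit [Fintype g.Site] [DecidableEq g.Site] in
/-- Corollary 3.8's locality, per direction. [cite: Balaban1985BackgroundPropagators, Cor. 3.8 (3.93)–(3.94) p.410, bookkeeping] -/
theorem localityDir_iff [Fintype Dir] : LocalityDir (opsRY 𝔬) (dirOps37RY 𝔡') (dirLetters37RY 𝔩) (walkReadingRY rd) ↔ LocalityDir 𝔬 𝔡' 𝔩 rd := by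
  constructor <;> rintro ⟨⟩ <;> constructor <;> assumption
omit [Fintype g.Site] [DecidableEq g.Site] in
/-- the walk reading's bookkeeping. [cite: Balaban1985BackgroundPropagators, Cor. 3.8 p.410, bookkeeping] -/
theorem walkReadingOK_iff (blk : X → g.Site) : (walkReadingRY rd).OK blk ↔ rd.OK blk := by
  constructor <;> rintro ⟨⟩ <;> constructor <;> assumption
omit [Fintype g.Site] [DecidableEq g.Site] in
/-- transposed direction pairs. [cite: Balaban1985BackgroundPropagators, (3.46) p.398, bookkeeping] -/
theorem dirTranspose37_iff [Fintype X] (U : (bg9Y 𝔸 G x).Cfg) : DirTranspose37 (opsRY 𝔬) (dirOps37RY 𝔡) U ↔ DirTranspose37 𝔬 𝔡 U := by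
  constructor <;> rintro ⟨⟩ <;> constructor <;> assumption
/-- (3.43)–(3.44) Hölder legs. [cite: Balaban1985BackgroundPropagators, (3.43)–(3.44) p.397, bookkeeping] -/
theorem holderLegs37_iff (R : ℝ) (H : Prop) (SH : ι → Finset g.Site) (Bl : ℝ → ℝ) (δ₀ : ℝ) (U : (bg9Y 𝔸 G x).Cfg) :
    HolderLegs37 (opsRY 𝔬) (holderProbesRY 𝔭) R H SH Bl δ₀ U ↔ HolderLegs37 𝔬 𝔭 R H SH Bl δ₀ U := by
  constructor <;> rintro ⟨⟩ <;> constructor <;> assumption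
/-- (3.44) Hölder V-term, per direction. [cite: Balaban1985BackgroundPropagators, (3.44) p.397, bookkeeping] -/
theorem holderV37Dir_iff [Fintype Dir] (R : ℝ) (H : Prop) (BV : ℝ → ℝ) (δ₀ : ℝ) (U : (bg9Y 𝔸 G x).Cfg) :
    HolderV37Dir (opsRY 𝔬) (dirOps37RY 𝔡') (dirLetters37RY 𝔩) (holderProbesRY 𝔭) R H BV δ₀ U ↔ HolderV37Dir 𝔬 𝔡' 𝔩 𝔭 R H BV δ₀ U := by
  constructor <;> rintro ⟨⟩ <;> constructor <;> assumption
/-- (3.46) second-order L² legs. [cite: Balaban1985BackgroundPropagators, (3.46) p.398 + Cor. 3.6 p.408, bookkeeping] -/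
theorem l2SecondLegs37_iff [Fintype X] (R : ℝ) (H : Prop) (S3 : ι → Finset g.Site) (B3 δ₀ : ℝ) (U : (bg9Y 𝔸 G x).Cfg) :
    L2SecondLegs37 (opsRY 𝔬) (dirOps37RY 𝔡) R H S3 B3 δ₀ U ↔ L2SecondLegs37 𝔬 𝔡 R H S3 B3 δ₀ U := by
  constructor <;> rintro ⟨⟩ <;> constructor <;> assumption
/-- (3.46) second-order factors. [cite: Balaban1985BackgroundPropagators, (3.46) p.398 + Cor. 3.6 p.408, bookkeeping] -/
theorem factorsL2Second37_iff [Fintype X] (R : ℝ) (H : Prop) (θ3 δ₀ : ℝ) (U : (bg9Y 𝔸 G x).Cfg) :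
    FactorsL2Second37 (opsRY 𝔬) (dirOps37RY 𝔡) R H θ3 δ₀ U ↔ FactorsL2Second37 𝔬 𝔡 R H θ3 δ₀ U := by
  constructor <;> rintro ⟨⟩ <;> constructor <;> assumption
/-- (3.46) second-order factors, per direction. [cite: Balaban1985BackgroundPropagators, (3.46) p.398 + (3.88) p.408, bookkeeping] -/
theorem factorsL2Second37Dir_iff [Fintype X] [Fintype Dir] (R : ℝ) (H : Prop) (θ3 δ₀ : ℝ) (U : (bg9Y 𝔸 G x).Cfg) :
    FactorsL2Second37Dir (opsRY 𝔬) (dirOps37RY 𝔡') (dirLetters37RY 𝔩) R H θ3 δ₀ U ↔ FactorsL2Second37Dir 𝔬 𝔡' 𝔩 R H θ3 δ₀ U := by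
  constructor <;> rintro ⟨⟩ <;> constructor <;> assumption
/-- (3.46)–(3.47) mixed legs. [cite: Balaban1985BackgroundPropagators, (3.46)–(3.47) p.398, bookkeeping] -/
theorem l2MixedLegs37_iff [Fintype X] (R : ℝ) (H : Prop) (SM : ι → Finset g.Site) (BM δ₀ : ℝ) (U : (bg9Y 𝔸 G x).Cfg) :
    L2MixedLegs37 (opsRY 𝔬) (dirOps37RY 𝔡) R H SM BM δ₀ U ↔ L2MixedLegs37 𝔬 𝔡 R H SM BM δ₀ U := by
  constructor <;> rintro ⟨⟩ <;> constructor <;> assumption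
/-- (3.46)–(3.47) mixed factors. [cite: Balaban1985BackgroundPropagators, (3.46)–(3.47) p.398, bookkeeping] -/
theorem factorsL2Mixed37_iff [Fintype X] (R : ℝ) (H : Prop) (θM δ₀ : ℝ) (U : (bg9Y 𝔸 G x).Cfg) :
    FactorsL2Mixed37 (opsRY 𝔬) (dirOps37RY 𝔡) R H θM δ₀ U ↔ FactorsL2Mixed37 𝔬 𝔡 R H θM δ₀ U := by
  constructor <;> rintro ⟨⟩ <;> constructor <;> assumption
/-- (3.46)–(3.47) mixed factors, per direction. [cite: Balaban1985BackgroundPropagators, (3.46)–(3.47) p.398 + (3.88) p.408, bookkeeping] -/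
theorem factorsL2Mixed37Dir_iff [Fintype X] [Fintype Dir] (R : ℝ) (H : Prop) (θM δ₀ : ℝ) (U : (bg9Y 𝔸 G x).Cfg) :
    FactorsL2Mixed37Dir (opsRY 𝔬) (dirOps37RY 𝔡') (dirLetters37RY 𝔩) R H θM δ₀ U ↔ FactorsL2Mixed37Dir 𝔬 𝔡' 𝔩 R H θM δ₀ U := by
  constructor <;> rintro ⟨⟩ <;> constructor <;> assumption
/-- (3.43)–(3.45) input legs, pair form. [cite: Balaban1985BackgroundPropagators, (3.43)–(3.45) pp.397–398, bookkeeping] -/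
theorem inputLegsPair37_iff [Fintype X] [Fintype PX] (R : ℝ) (H : Prop) (bHX : ℝ → BlockNorm (toB6 g R H) (X → ℝ))
    (SI : ι → Finset g.Site) (BI : ℝ → ℝ) (BI2 : ℝ → ℝ → ℝ) (δ₀ : ℝ) (U : (bg9Y 𝔸 G x).Cfg) :
    InputLegsPair37 (opsRY 𝔬) (dirOps37RY 𝔡) (holderProbesRY 𝔭) R H bHX SI BI BI2 δ₀ U ↔ InputLegsPair37 𝔬 𝔡 𝔭 R H bHX SI BI BI2 δ₀ U := by
  constructor <;> rintro ⟨⟩ <;> constructor <;> assumption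
/-- (3.45) input factors. [cite: Balaban1985BackgroundPropagators, (3.45) p.398, bookkeeping] -/
theorem factorsInputPair37_iff [Fintype X] (R : ℝ) (H : Prop) (bHX : ℝ → BlockNorm (toB6 g R H) (X → ℝ)) (θI : ℝ → ℝ) (δ₀ : ℝ)
    (U : (bg9Y 𝔸 G x).Cfg) :
    FactorsInputPair37 (opsRY 𝔬) (dirOps37RY 𝔡) R H bHX θI δ₀ U ↔ FactorsInputPair37 𝔬 𝔡 R H bHX θI δ₀ U := by
  constructor <;> rintro ⟨⟩ <;> constructor <;> assumption
/-- (3.45) input factors, per direction. [cite: Balaban1985BackgroundPropagators, (3.45) p.398 + (3.88) p.408, bookkeeping] -/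
theorem factorsInputPair37Dir_iff [Fintype X] [Fintype Dir] (R : ℝ) (H : Prop) (bHX : ℝ → BlockNorm (toB6 g R H) (X → ℝ)) (θI : ℝ → ℝ) (δ₀ : ℝ)
    (U : (bg9Y 𝔸 G x).Cfg) :
    FactorsInputPair37Dir (opsRY 𝔬) (dirOps37RY 𝔡') (dirLetters37RY 𝔩) R H bHX θI δ₀ U ↔ FactorsInputPair37Dir 𝔬 𝔡' 𝔩 R H bHX θI δ₀ U := by
  constructor <;> rintro ⟨⟩ <;> constructor <;> assumption
omit [DecidableEq g.Site] in
/-- direction-sup bookkeeping (squares). [cite: Balaban1985BackgroundPropagators, (3.46) p.398, bookkeeping] -/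
theorem dirSupSq37_iff [Fintype X] [Fintype Y] (R : ℝ) (H : Prop) (U : (bg9Y 𝔸 G x).Cfg) :
    DirSupSq37 (opsRY 𝔬) (dirOps37RY 𝔡') R H U ↔ DirSupSq37 𝔬 𝔡' R H U := by
  constructor <;> rintro ⟨⟩ <;> constructor <;> assumption
omit [DecidableEq g.Site] in
/-- direction-sup bookkeeping. [cite: Balaban1985BackgroundPropagators, (3.46) p.398, bookkeeping] -/
theorem dirSup37_iff [Fintype X] [Fintype Y] (R : ℝ) (H : Prop) (U : (bg9Y 𝔸 G x).Cfg) :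
    DirSup37 (opsRY 𝔬) (dirOps37RY 𝔡) R H U ↔ DirSup37 𝔬 𝔡 R H U := by
  constructor <;> rintro ⟨⟩ <;> constructor <;> assumption
omit [DecidableEq g.Site] in
/-- direction-sup bookkeeping (Hölder probes). [cite: Balaban1985BackgroundPropagators, (3.43)–(3.44) p.397, bookkeeping] -/
theorem dirSupHolder37_iff [Fintype X] [Fintype PX] [Fintype PY] (R : ℝ) (H : Prop) (U : (bg9Y 𝔸 G x).Cfg) :
    DirSupHolder37 (opsRY 𝔬) (dirOps37RY 𝔡) (holderProbesRY 𝔭) R H U ↔ DirSupHolder37 𝔬 𝔡 𝔭 R H U := by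
  constructor <;> rintro ⟨⟩ <;> constructor <;> assumption

/-- (3.46) first-order L² legs («two legs»). [cite: Balaban1985BackgroundPropagators, (3.46) p.398 + Cor. 3.6 p.408, bookkeeping] -/
theorem l2TwoLegs37_iff [Fintype Y] (R : ℝ) (H : Prop) (S2 : ι → Finset g.Site) (B2 δ₀ : ℝ) (U : (bg9Y 𝔸 G x).Cfg) :
    L2TwoLegs37 (opsRY 𝔬) R H S2 B2 δ₀ U ↔ L2TwoLegs37 𝔬 R H S2 B2 δ₀ U := by
  constructor <;> rintro ⟨⟩ <;> constructor <;> assumption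
/-- (3.46) first-order factors. [cite: Balaban1985BackgroundPropagators, (3.46) p.398 + Cor. 3.6 p.408, bookkeeping] -/
theorem factorsL2_37_iff [Fintype X] [Fintype Y] (R : ℝ) (H : Prop) (θ2 δ₀ : ℝ) (U : (bg9Y 𝔸 G x).Cfg) :
    FactorsL2_37 (opsRY 𝔬) R H θ2 δ₀ U ↔ FactorsL2_37 𝔬 R H θ2 δ₀ U := by
  constructor <;> rintro ⟨⟩ <;> constructor <;> assumption
/-- (3.43)–(3.45) input legs. [cite: Balaban1985BackgroundPropagators, (3.43)–(3.45) pp.397–398, bookkeeping] -/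
theorem inputLegs37_iff [Fintype Y] [Fintype PY] (R : ℝ) (H : Prop) (bH : ℝ → BlockNorm (toB6 g R H) (Y → ℝ)) (SI : ι → Finset g.Site) (BI : ℝ → ℝ)
    (BI2 : ℝ → ℝ → ℝ) (δ₀ : ℝ) (U : (bg9Y 𝔸 G x).Cfg) :
    InputLegs37 (opsRY 𝔬) (holderProbesRY 𝔭) R H bH SI BI BI2 δ₀ U ↔ InputLegs37 𝔬 𝔭 R H bH SI BI BI2 δ₀ U := by
  constructor <;> rintro ⟨⟩ <;> constructor <;> assumption

end Bridges37

/-! ## §3 ★★ Schema bridges, Theorem-3.10 layer -/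

section Bridges310

variable [Fintype g.Site] [DecidableEq g.Site] {X Y ι A P Dir PX PY : Type}
variable (𝔬 : Ops310 g (bg9YR 𝔸 G R₁ R₂ x) X Y ι A) (𝔡 : DirOps310 𝔬 P) (𝔡' : DirOps310 𝔬 Dir) (𝔩 : DirLetters310 𝔬 Dir)
  (𝔭 : HolderProbes g (bg9YR 𝔸 G R₁ R₂ x) X Y PX PY) (rd : WalkReading310 g (bg9YR 𝔸 G R₁ R₂ x) X ι A)

/-- (3.105)'s static letters. [cite: Balaban1985BackgroundPropagators, (3.105)–(3.107) p.415, bookkeeping] -/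
theorem staticOK310_iff [Fintype ι] [Fintype A] (ρ N N' NF Cℓ : ℝ) (κ : Sizes310) :
    StaticOK310 (ops310RY 𝔬) ρ N N' NF Cℓ κ ↔ StaticOK310 𝔬 ρ N N' NF Cℓ κ := by
  constructor <;> rintro ⟨⟩ <;> constructor <;> assumption
omit [DecidableEq g.Site] in
/-- (3.42) for `G`, localized. [cite: Balaban1985BackgroundPropagators, (3.42) p.397 + Thm 3.10 p.416, bookkeeping] -/
theorem local342G_iff (R : ℝ) (H : Prop) (B₀ δ₀ : ℝ) (U : (bg9Y 𝔸 G x).Cfg) : Local342G (ops310RY 𝔬) R H B₀ δ₀ U ↔ Local342G 𝔬 R H B₀ δ₀ U := by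
  constructor <;> rintro ⟨⟩ <;> constructor <;> assumption
omit [DecidableEq g.Site] in
/-- Theorem 3.10's operator identities. [cite: Balaban1985BackgroundPropagators, (3.105)–(3.106) p.415, bookkeeping] -/
theorem identities310_iff [Fintype A] [Fintype ι] (R : ℝ) (H : Prop) (U : (bg9Y 𝔸 G x).Cfg) :
    Identities310 (ops310RY 𝔬) R H U ↔ Identities310 𝔬 R H U := by
  constructor <;> rintro ⟨⟩ <;> constructor <;> assumption
omit [DecidableEq g.Site] in
/-- Theorem 3.10's per-direction identities. [cite: Balaban1985BackgroundPropagators, (3.105)–(3.106) p.415, bookkeeping] -/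
theorem identities310₂_iff [Fintype A] [Fintype ι] [Fintype Dir] (R : ℝ) (H : Prop) (U : (bg9Y 𝔸 G x).Cfg) :
    Identities310₂ (ops310RY 𝔬) (dirOps310RY 𝔡') (dirLetters310RY 𝔩) R H U ↔ Identities310₂ 𝔬 𝔡' 𝔩 R H U := by
  constructor <;> rintro ⟨⟩ <;> constructor <;> assumption
omit [Fintype g.Site] [DecidableEq g.Site] in
/-- Theorem 3.10's locality. [cite: Balaban1985BackgroundPropagators, Thm 3.10 p.416 + Cor. 3.8 p.410, bookkeeping] -/
theorem locality310_iff : Locality310 (ops310RY 𝔬) (walkReading310RY rd) ↔ Locality310 𝔬 rd := by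
  constructor <;> rintro ⟨⟩ <;> constructor <;> assumption
omit [Fintype g.Site] [DecidableEq g.Site] in
/-- the walk reading's bookkeeping. [cite: Balaban1985BackgroundPropagators, Thm 3.10 p.416, bookkeeping] -/
theorem walkReading310OK_iff (blk : X → g.Site) : (walkReading310RY rd).OK blk ↔ rd.OK blk := by
  constructor <;> rintro ⟨⟩ <;> constructor <;> assumption
omit [Fintype g.Site] [DecidableEq g.Site] in
/-- transposed direction pairs. [cite: Balaban1985BackgroundPropagators, (3.46) p.398, bookkeeping] -/
theorem dirTranspose310_iff [Fintype X] (U : (bg9Y 𝔸 G x).Cfg) : DirTranspose310 (ops310RY 𝔬) (dirOps310RY 𝔡) U ↔ DirTranspose310 𝔬 𝔡 U := by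
  constructor <;> rintro ⟨⟩ <;> constructor <;> assumption
/-- (3.43)–(3.44) Hölder legs. [cite: Balaban1985BackgroundPropagators, (3.43)–(3.44) p.397 + Thm 3.10 p.416, bookkeeping] -/
theorem holderLegs310_iff (R : ℝ) (H : Prop) (SH : ι → Finset g.Site) (Bl : ℝ → ℝ) (δ₀ : ℝ) (U : (bg9Y 𝔸 G x).Cfg) :
    HolderLegs310 (ops310RY 𝔬) (holderProbesRY 𝔭) R H SH Bl δ₀ U ↔ HolderLegs310 𝔬 𝔭 R H SH Bl δ₀ U := by
  constructor <;> rintro ⟨⟩ <;> constructor <;> assumption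
/-- (3.44) Hölder factors. [cite: Balaban1985BackgroundPropagators, (3.44) p.397 + Thm 3.10 p.416, bookkeeping] -/
theorem factorsHolder310_iff (R : ℝ) (H : Prop) (θH : ℝ → ℝ) (δ₀ : ℝ) (U : (bg9Y 𝔸 G x).Cfg) :
    FactorsHolder310 (ops310RY 𝔬) (holderProbesRY 𝔭) R H θH δ₀ U ↔ FactorsHolder310 𝔬 𝔭 R H θH δ₀ U := by
  constructor <;> rintro ⟨⟩ <;> constructor <;> assumption
/-- (3.46) second-order L² legs. [cite: Balaban1985BackgroundPropagators, (3.46) p.398 + Thm 3.10 p.416, bookkeeping] -/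
theorem l2SecondLegs310_iff [Fintype X] (R : ℝ) (H : Prop) (S3 : ι → Finset g.Site) (B3 δ₀ : ℝ) (U : (bg9Y 𝔸 G x).Cfg) :
    L2SecondLegs310 (ops310RY 𝔬) (dirOps310RY 𝔡) R H S3 B3 δ₀ U ↔ L2SecondLegs310 𝔬 𝔡 R H S3 B3 δ₀ U := by
  constructor <;> rintro ⟨⟩ <;> constructor <;> assumption
/-- (3.46) second-order factors. [cite: Balaban1985BackgroundPropagators, (3.46) p.398 + Thm 3.10 p.416, bookkeeping] -/
theorem factorsL2Second310_iff [Fintype X] (R : ℝ) (H : Prop) (θ3 δ₀ : ℝ) (U : (bg9Y 𝔸 G x).Cfg) :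
    FactorsL2Second310 (ops310RY 𝔬) (dirOps310RY 𝔡) R H θ3 δ₀ U ↔ FactorsL2Second310 𝔬 𝔡 R H θ3 δ₀ U := by
  constructor <;> rintro ⟨⟩ <;> constructor <;> assumption
/-- (3.46)–(3.47) mixed legs. [cite: Balaban1985BackgroundPropagators, (3.46)–(3.47) p.398 + Thm 3.10 p.416, bookkeeping] -/
theorem l2MixedLegs310_iff [Fintype X] (R : ℝ) (H : Prop) (SM : ι → Finset g.Site) (BM δ₀ : ℝ) (U : (bg9Y 𝔸 G x).Cfg) :
    L2MixedLegs310 (ops310RY 𝔬) (dirOps310RY 𝔡) R H SM BM δ₀ U ↔ L2MixedLegs310 𝔬 𝔡 R H SM BM δ₀ U := by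
  constructor <;> rintro ⟨⟩ <;> constructor <;> assumption
/-- (3.46)–(3.47) mixed factors. [cite: Balaban1985BackgroundPropagators, (3.46)–(3.47) p.398 + Thm 3.10 p.416, bookkeeping] -/
theorem factorsL2Mixed310_iff [Fintype X] (R : ℝ) (H : Prop) (θM δ₀ : ℝ) (U : (bg9Y 𝔸 G x).Cfg) :
    FactorsL2Mixed310 (ops310RY 𝔬) (dirOps310RY 𝔡) R H θM δ₀ U ↔ FactorsL2Mixed310 𝔬 𝔡 R H θM δ₀ U := by
  constructor <;> rintro ⟨⟩ <;> constructor <;> assumption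
/-- (3.43)–(3.45) input legs, pair form. [cite: Balaban1985BackgroundPropagators, (3.43)–(3.45) pp.397–398 + Thm 3.10 p.416, bookkeeping] -/
theorem inputLegsPair310_iff [Fintype X] [Fintype PX] (R : ℝ) (H : Prop) (bHX : ℝ → BlockNorm (toB6 g R H) (X → ℝ))
    (SI : ι → Finset g.Site) (BI : ℝ → ℝ) (BI2 : ℝ → ℝ → ℝ) (δ₀ : ℝ) (U : (bg9Y 𝔸 G x).Cfg) :
    InputLegsPair310 (ops310RY 𝔬) (dirOps310RY 𝔡) (holderProbesRY 𝔭) R H bHX SI BI BI2 δ₀ U ↔ InputLegsPair310 𝔬 𝔡 𝔭 R H bHX SI BI BI2 δ₀ U := by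
  constructor <;> rintro ⟨⟩ <;> constructor <;> assumption
/-- (3.45) input factors. [cite: Balaban1985BackgroundPropagators, (3.45) p.398 + Thm 3.10 p.416, bookkeeping] -/
theorem factorsInputPair310_iff [Fintype X] (R : ℝ) (H : Prop) (bHX : ℝ → BlockNorm (toB6 g R H) (X → ℝ)) (θI : ℝ → ℝ) (δ₀ : ℝ)
    (U : (bg9Y 𝔸 G x).Cfg) :
    FactorsInputPair310 (ops310RY 𝔬) (dirOps310RY 𝔡) R H bHX θI δ₀ U ↔ FactorsInputPair310 𝔬 𝔡 R H bHX θI δ₀ U := by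
  constructor <;> rintro ⟨⟩ <;> constructor <;> assumption

/-- (3.46) first-order L² legs («two legs»). [cite: Balaban1985BackgroundPropagators, (3.46) p.398 + Thm 3.10 p.416, bookkeeping] -/
theorem l2TwoLegs310_iff [Fintype Y] (R : ℝ) (H : Prop) (S2 : ι → Finset g.Site) (B2 δ₀ : ℝ) (U : (bg9Y 𝔸 G x).Cfg) :
    L2TwoLegs310 (ops310RY 𝔬) R H S2 B2 δ₀ U ↔ L2TwoLegs310 𝔬 R H S2 B2 δ₀ U := by
  constructor <;> rintro ⟨⟩ <;> constructor <;> assumption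
/-- (3.46) first-order factors. [cite: Balaban1985BackgroundPropagators, (3.46) p.398 + Thm 3.10 p.416, bookkeeping] -/
theorem factorsL2_310_iff [Fintype X] [Fintype Y] (R : ℝ) (H : Prop) (θ2 δ₀ : ℝ) (U : (bg9Y 𝔸 G x).Cfg) :
    FactorsL2_310 (ops310RY 𝔬) R H θ2 δ₀ U ↔ FactorsL2_310 𝔬 R H θ2 δ₀ U := by
  constructor <;> rintro ⟨⟩ <;> constructor <;> assumption
/-- (3.43)–(3.45) input legs. [cite: Balaban1985BackgroundPropagators, (3.43)–(3.45) pp.397–398 + Thm 3.10 p.416, bookkeeping] -/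
theorem inputLegs310_iff [Fintype Y] [Fintype PY] (R : ℝ) (H : Prop) (bH : ℝ → BlockNorm (toB6 g R H) (Y → ℝ)) (SI : ι → Finset g.Site) (BI : ℝ → ℝ)
    (BI2 : ℝ → ℝ → ℝ) (δ₀ : ℝ) (U : (bg9Y 𝔸 G x).Cfg) :
    InputLegs310 (ops310RY 𝔬) (holderProbesRY 𝔭) R H bH SI BI BI2 δ₀ U ↔ InputLegs310 𝔬 𝔭 R H bH SI BI BI2 δ₀ U := by
  constructor <;> rintro ⟨⟩ <;> constructor <;> assumption
omit [DecidableEq g.Site] in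
/-- direction-sup bookkeeping (squares). [cite: Balaban1985BackgroundPropagators, (3.46) p.398 + Thm 3.10 p.416, bookkeeping] -/
theorem dirSupSq310_iff [Fintype X] [Fintype Y] (R : ℝ) (H : Prop) (U : (bg9Y 𝔸 G x).Cfg) :
    DirSupSq310 (ops310RY 𝔬) (dirOps310RY 𝔡') R H U ↔ DirSupSq310 𝔬 𝔡' R H U := by
  constructor <;> rintro ⟨⟩ <;> constructor <;> assumption
omit [DecidableEq g.Site] in
/-- direction-sup bookkeeping. [cite: Balaban1985BackgroundPropagators, (3.46) p.398 + Thm 3.10 p.416, bookkeeping] -/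
theorem dirSup310_iff [Fintype X] [Fintype Y] (R : ℝ) (H : Prop) (U : (bg9Y 𝔸 G x).Cfg) :
    DirSup310 (ops310RY 𝔬) (dirOps310RY 𝔡) R H U ↔ DirSup310 𝔬 𝔡 R H U := by
  constructor <;> rintro ⟨⟩ <;> constructor <;> assumption
omit [DecidableEq g.Site] in
/-- direction-sup bookkeeping (Hölder probes). [cite: Balaban1985BackgroundPropagators, (3.43)–(3.44) p.397 + Thm 3.10 p.416, bookkeeping] -/
theorem dirSupHolder310_iff [Fintype X] [Fintype PX] [Fintype PY] (R : ℝ) (H : Prop) (U : (bg9Y 𝔸 G x).Cfg) :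
    DirSupHolder310 (ops310RY 𝔬) (dirOps310RY 𝔡) (holderProbesRY 𝔭) R H U ↔ DirSupHolder310 𝔬 𝔡 𝔭 R H U := by
  constructor <;> rintro ⟨⟩ <;> constructor <;> assumption

end Bridges310

/-! ## §4 ★ Schema bridges, Sect.-D layer (Theorems 3.12–3.13) -/

section Bridges312

variable [Fintype g.Site] {X Y Z W : Type}
variable (𝔬 : B9Thm312Whole.Ops g (bg9YR 𝔸 G R₁ R₂ x) X Y Z W)

/-- the (3.131) letters with the `H`-block norm. [cite: Balaban1985BackgroundPropagators, (3.131) p.421 + (3.138) p.423, bookkeeping] -/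
theorem letters3131H_iff [Fintype X] [Fintype Z] [Fintype W] (Tb Tb₂ : (bg9Y 𝔸 G x).Cfg → (X → ℝ) →ₗ[ℝ] (W → ℝ)) (R₀ : ℝ) (H₀ : Prop) (hlen : ∀ y : g.Site, 0 ≤ g.len y)
    (bH : BlockNorm (toB6 g R₀ H₀) (W → ℝ)) (t δT : ℝ) (U : (bg9Y 𝔸 G x).Cfg) :
    Letters3131H (ops312RY 𝔬) Tb Tb₂ R₀ H₀ hlen bH t δT U ↔ Letters3131H 𝔬 Tb Tb₂ R₀ H₀ hlen bH t δT U := by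
  constructor <;> rintro ⟨⟩ <;> constructor <;> assumption
/-- the `H ∕ Z` letters of (3.147)–(3.148). [cite: Balaban1985BackgroundPropagators, (3.147)–(3.148) p.425, bookkeeping] -/
theorem lettersHZ_iff [Fintype X] [Fintype Y] [Fintype Z] [Fintype W] (R₀ : ℝ) (H₀ : Prop) (hG : GeoOK g) (bZ : BlockNorm (toB6 g R₀ H₀) (Z → ℝ)) (B₃ δ₃ : ℝ) (U : (bg9Y 𝔸 G x).Cfg) :
    LettersHZ (ops312RY 𝔬) R₀ H₀ hG bZ B₃ δ₃ U ↔ LettersHZ 𝔬 R₀ H₀ hG bZ B₃ δ₃ U := by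
  constructor <;> rintro ⟨⟩ <;> constructor <;> assumption

end Bridges312

end Literature.MathematicalPhysics.QuantumFieldTheory.Balaban1983to89.B9OpsRTransport

end
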